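import Summits.CriticalPhenomena.SAWScalingLimit.Theorems.SAWWeldingIdentificationWeldingContinuityBankIndex
import Literature.Topology.PlaneTopology.CrosscutProofs
import Literature.Topology.PlaneTopology.ArcLoops

/-!
# Welding continuity, part B: the two banks of a cross-cut of a conformal rectangle as Jordan domains

Support file for item `stmt-CriticalPhenomena-4509` (`SAWWeldingIdentification.WeldingContinuity`).

Let `Q = (Ω; a, c_L, b, c_R)` be a conformal rectangle (marks `m₀ < m₁ < m₂ < m₃` in `[0, 1)`,
`a = Q.pt 0 = β m₀`, `c_L = β m₁`, `b = β m₂`, `c_R = β m₃`, `β = Q.boundary`) and let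
`P : ℝ → ℂ` parametrise a cross-cut of `Ω` from `a` to `b` on `[0, 1]` (continuous, injective on
`[0, 1]`, `P 0 = a`, `P 1 = b`, `P (0,1) ⊆ Ω`). Newman's cross-cut theorem
(`Newman1939_crosscut_holds`) splits `Ω ∖ P[0,1]` into two domains `U₁`, `U₂` with frontiers
`P[0,1] ∪ β[m₀, m₂]` and `P[0,1] ∪ β[m₂, m₀ + 1]`. We package them as **Jordan domains**
`DL`, `DR` (`exists_banks`) whose boundary loops are the EXPLICIT concatenations
(`Literature.Topology.PlaneTopology.concatPath`, periodised by `Int.fract`)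

* `DL.boundary = concatPath P (u ↦ β (m₂ + u (m₀ - m₂))) ∘ fract` (`P`, then `β` backwards through `c_L`),
* `DR.boundary = concatPath P (u ↦ β (m₂ + u (m₀ + 1 - m₂))) ∘ fract` (`P`, then `β` forwards through `c_R`),

so that uniformly convergent chords give uniformly convergent bank loops (Radó's hypothesis), and
we record the **indices of the banks**: `DL.index = -Q.index`, `DR.index = Q.index` on the
respective banks (`index_left_eq`, `index_right_eq`; from part A).

References: Newman (1939), Ch. V §11 Thms. 11·7–11·8; Ahlfors (1979), Ch. 4 §2.1.
-/

noncomputable section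

open Set Filter Metric Complex
open Literature.Probability.RandomPlanarGeometry Literature.Topology.PlaneTopology

namespace Summit.CriticalPhenomena.SAWScalingLimit.Theorems.WeldingContinuity

/-! ### Affine reparametrisations of boundary arcs -/

/-- Image of `[0, 1]` under `u ↦ c + u d` for `d ≤ 0`. [folklore] -/
theorem image_affine_Icc_of_nonpos {c d : ℝ} (hd : d ≤ 0) :
    (fun u : ℝ => c + u * d) '' Icc 0 1 = Icc (c + d) c := by
  ext s
  constructor
  · rintro ⟨u, hu, rfl⟩
    exact ⟨by nlinarith [hu.2], by nlinarith [hu.1]⟩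
  · intro hs
    rcases eq_or_lt_of_le hd with rfl | hd'
    · refine ⟨0, ⟨le_rfl, zero_le_one⟩, ?_⟩
      simp only [zero_mul, add_zero]
      have : s = c := le_antisymm hs.2 (by simpa using hs.1)
      exact this.symm
    · have hd0 : d ≠ 0 := hd'.ne
      refine ⟨(s - c) / d, ⟨div_nonneg_of_nonpos (by linarith [hs.2]) hd'.le, ?_⟩, ?_⟩
      · rw [div_le_one_of_neg hd']; linarith [hs.1]
      · field_simp; ring

/-- Image of `[0, 1]` under `u ↦ c + u d` for `0 ≤ d`. [folklore] -/
theorem image_affine_Icc_of_nonneg {c d : ℝ} (hd : 0 ≤ d) :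
    (fun u : ℝ => c + u * d) '' Icc 0 1 = Icc c (c + d) := by
  ext s
  constructor
  · rintro ⟨u, hu, rfl⟩
    exact ⟨by nlinarith [hu.1], by nlinarith [hu.2]⟩
  · intro hs
    rcases eq_or_lt_of_le hd with rfl | hd'
    · refine ⟨0, ⟨le_rfl, zero_le_one⟩, ?_⟩
      simp only [zero_mul, add_zero]
      have : s = c := le_antisymm (by simpa using hs.2) hs.1
      exact this.symm
    · have hd0 : d ≠ 0 := hd'.ne'
      refine ⟨(s - c) / d, ⟨div_nonneg (by linarith [hs.1]) hd'.le, ?_⟩, ?_⟩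
      · rw [div_le_one hd']; linarith [hs.2]
      · field_simp; ring

/-- The backward boundary arc `u ↦ β (m₂ + u (m₀ - m₂))` traces `β [m₀, m₂]`. [folklore] -/
theorem image_arcL (Q : JordanDomain) {m₀ m₂ : ℝ} (h02 : m₀ ≤ m₂) :
    (fun u : ℝ => Q.boundary (m₂ + u * (m₀ - m₂))) '' Icc 0 1 = Q.boundary '' Icc m₀ m₂ := by
  rw [show (fun u : ℝ => Q.boundary (m₂ + u * (m₀ - m₂))) =
      Q.boundary ∘ fun u : ℝ => m₂ + u * (m₀ - m₂) from rfl, image_comp,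
    image_affine_Icc_of_nonpos (by linarith)]
  congr 1
  rw [show m₂ + (m₀ - m₂) = m₀ by ring]

/-- The forward boundary arc `u ↦ β (m₂ + u (m₀ + 1 - m₂))` traces `β [m₂, m₀ + 1]`. [folklore] -/
theorem image_arcR (Q : JordanDomain) {m₀ m₂ : ℝ} (h20 : m₂ ≤ m₀ + 1) :
    (fun u : ℝ => Q.boundary (m₂ + u * (m₀ + 1 - m₂))) '' Icc 0 1 =
      Q.boundary '' Icc m₂ (m₀ + 1) := by
  rw [show (fun u : ℝ => Q.boundary (m₂ + u * (m₀ + 1 - m₂))) =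
      Q.boundary ∘ fun u : ℝ => m₂ + u * (m₀ + 1 - m₂) from rfl, image_comp,
    image_affine_Icc_of_nonneg (by linarith)]
  congr 1
  rw [show m₂ + (m₀ + 1 - m₂) = m₀ + 1 by ring]

/-- The backward boundary arc is injective on `[0, 1]` (`m₀ < m₂ < m₀ + 1`). [folklore] -/
theorem injOn_arcL (Q : JordanDomain) {m₀ m₂ : ℝ} (h02 : m₀ < m₂) (h20 : m₂ < m₀ + 1) :
    InjOn (fun u : ℝ => Q.boundary (m₂ + u * (m₀ - m₂))) (Icc 0 1) := by
  intro u hu u' hu' h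
  have hinj := Q.injOn_boundary_Icc (s := m₀) (t := m₂) h20
  have e := hinj ⟨by nlinarith [hu.2], by nlinarith [hu.1]⟩ ⟨by nlinarith [hu'.2], by nlinarith [hu'.1]⟩ h
  have : (u - u') * (m₀ - m₂) = 0 := by linarith
  rcases mul_eq_zero.1 this with h1 | h1
  · linarith
  · linarith

/-- The forward boundary arc is injective on `[0, 1]` (`m₀ < m₂ < m₀ + 1`). [folklore] -/
theorem injOn_arcR (Q : JordanDomain) {m₀ m₂ : ℝ} (h02 : m₀ < m₂) (h20 : m₂ < m₀ + 1) :
    InjOn (fun u : ℝ => Q.boundary (m₂ + u * (m₀ + 1 - m₂))) (Icc 0 1) := by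
  intro u hu u' hu' h
  have hinj := Q.injOn_boundary_Icc (s := m₂) (t := m₀ + 1) (by linarith)
  have e := hinj ⟨by nlinarith [hu.1], by nlinarith [hu.2]⟩ ⟨by nlinarith [hu'.1], by nlinarith [hu'.2]⟩ h
  have : (u - u') * (m₀ + 1 - m₂) = 0 := by linarith
  rcases mul_eq_zero.1 this with h1 | h1
  · linarith
  · linarith

/-! ### Cross-cut data of a chord parametrisation -/

section Chord

variable (Q : ConformalRectangle) {P : ℝ → ℂ}

/-- Marks of a conformal rectangle: `m₀ < m₂`. [folklore] -/
theorem mark_zero_lt_mark_two : Q.mark 0 < Q.mark 2 := Q.strictMono_mark (by decide)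

/-- Marks of a conformal rectangle: `m₂ < m₀ + 1`. [folklore] -/
theorem mark_two_lt_mark_zero_add_one : Q.mark 2 < Q.mark 0 + 1 := by
  linarith [(Q.mark_mem 2).2, (Q.mark_mem 0).1]

/-- A chord parametrisation meets the frontier only at its endpoints: `P t ∉ ∂Ω` for
`0 < t < 1`. [folklore] -/
theorem chord_not_mem_frontier (hPΩ : ∀ t ∈ Ioo (0 : ℝ) 1, P t ∈ Q.carrier) {t : ℝ}
    (ht : t ∈ Ioo (0 : ℝ) 1) : P t ∉ frontier Q.carrier := fun h =>
  (Set.disjoint_left.1 Q.toJordanDomain.disjoint_carrier_frontier) (hPΩ t ht) h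

/-- The trace of a chord meets `∂Ω` inside `{a, b}`. [folklore] -/
theorem image_chord_inter_frontier (hP0 : P 0 = Q.pt 0) (hP1 : P 1 = Q.pt 2)
    (hPΩ : ∀ t ∈ Ioo (0 : ℝ) 1, P t ∈ Q.carrier) :
    P '' Icc 0 1 ∩ frontier Q.carrier ⊆ {Q.pt 0, Q.pt 2} := by
  rintro _ ⟨⟨t, ht, rfl⟩, hfr⟩
  rcases ht.1.eq_or_lt with rfl | h0
  · exact Or.inl hP0
  rcases ht.2.lt_or_eq with h1 | rfl
  · exact absurd hfr (chord_not_mem_frontier Q hPΩ ⟨h0, h1⟩)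
  · exact Or.inr hP1

/-- A chord parametrisation defines a cross-cut of `Ω` from `a = β m₀` to `b = β m₂`. [folklore] -/
theorem isCrosscut_chord (hPc : Continuous P) (hPi : InjOn P (Icc 0 1)) (hP0 : P 0 = Q.pt 0)
    (hP1 : P 1 = Q.pt 2) (hPΩ : ∀ t ∈ Ioo (0 : ℝ) 1, P t ∈ Q.carrier) :
    Q.toJordanDomain.IsCrosscut (P '' Icc 0 1) (Q.boundary (Q.mark 0)) (Q.boundary (Q.mark 2)) := by
  refine ⟨⟨P, hPc.continuousOn, hPi, rfl, hP0, hP1⟩, Q.pt_mem_frontier 0, Q.pt_mem_frontier 2,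
    fun h => absurd (Q.pt_injective h) (by decide), ?_⟩
  rintro _ ⟨⟨t, ht, rfl⟩, hne⟩
  rcases ht.1.eq_or_lt with rfl | h0
  · exact absurd (Or.inl hP0) hne
  rcases ht.2.lt_or_eq with h1 | rfl
  · exact hPΩ t ⟨h0, h1⟩
  · exact absurd (Or.inr hP1) hne

/-- **The two banks of a chord as Jordan domains.** For a chord parametrisation `P` of the
conformal rectangle `Q` there are Jordan domains `DL`, `DR` — the two components of `Ω ∖ P[0,1]`
given by Newman's cross-cut theorem — whose boundary loops are the explicit concatenations "`P`,
then `∂Ω` backwards from `b` through `c_L` to `a`" and "`P`, then `∂Ω` forwards from `b` through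
`c_R` to `a`", with frontiers `P[0,1] ∪ β[m₀, m₂]` and `P[0,1] ∪ β[m₂, m₀ + 1]`.
[cite: Newman1939, Ch. V §11, Thms. 11·7 and 11·8, pp. 94–95] -/
theorem exists_banks (hPc : Continuous P) (hPi : InjOn P (Icc 0 1)) (hP0 : P 0 = Q.pt 0)
    (hP1 : P 1 = Q.pt 2) (hPΩ : ∀ t ∈ Ioo (0 : ℝ) 1, P t ∈ Q.carrier) :
    ∃ DL DR : JordanDomain,
      DL.boundary = concatPath P (fun u => Q.boundary (Q.mark 2 + u * (Q.mark 0 - Q.mark 2))) ∘ Int.fract ∧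
      DR.boundary = concatPath P (fun u => Q.boundary (Q.mark 2 + u * (Q.mark 0 + 1 - Q.mark 2))) ∘ Int.fract ∧
      DL.carrier ∪ DR.carrier = Q.carrier \ P '' Icc 0 1 ∧ Disjoint DL.carrier DR.carrier ∧
      frontier DL.carrier = P '' Icc 0 1 ∪ Q.boundary '' Icc (Q.mark 0) (Q.mark 2) ∧
      frontier DR.carrier = P '' Icc 0 1 ∪ Q.boundary '' Icc (Q.mark 2) (Q.mark 0 + 1) := by
  have h02 := mark_zero_lt_mark_two Q
  have h20 := mark_two_lt_mark_zero_add_one Q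
  obtain ⟨U₁, U₂, hU₁o, hU₂o, hU₁c, hU₂c, hdisj, hunion, hf₁, hf₂⟩ :=
    Newman1939_crosscut_holds Q.toJordanDomain (P '' Icc 0 1) (Q.mark 0) (Q.mark 2) h02 h20
      (isCrosscut_chord Q hPc hPi hP0 hP1 hPΩ)
  have hU₁Q : U₁ ⊆ Q.carrier := fun z hz => (hunion.le (Or.inl hz)).1
  have hU₂Q : U₂ ⊆ Q.carrier := fun z hz => (hunion.le (Or.inr hz)).1
  -- the two arcs
  set AL : ℝ → ℂ := fun u => Q.boundary (Q.mark 2 + u * (Q.mark 0 - Q.mark 2)) with hAL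
  set AR : ℝ → ℂ := fun u => Q.boundary (Q.mark 2 + u * (Q.mark 0 + 1 - Q.mark 2)) with hAR
  have hALc : Continuous AL := Q.continuous_boundary.comp (by fun_prop)
  have hARc : Continuous AR := Q.continuous_boundary.comp (by fun_prop)
  have hPAL : P 1 = AL 0 := by simp only [hAL, hP1]; ring_nf; rfl
  have hPAR : P 1 = AR 0 := by simp only [hAR, hP1]; ring_nf; rfl
  have hALP : AL 1 = P 0 := by simp only [hAL, hP0]; ring_nf; rfl
  have hARP : AR 1 = P 0 := by
    simp only [hAR, hP0]
    rw [show Q.mark 2 + 1 * (Q.mark 0 + 1 - Q.mark 2) = Q.mark 0 + 1 by ring, Q.periodic_boundary]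
    rfl
  have h01L : concatPath P AL 0 = concatPath P AL 1 := by
    rw [concatPath_zero, concatPath_one, hALP]
  have h01R : concatPath P AR 0 = concatPath P AR 1 := by
    rw [concatPath_zero, concatPath_one, hARP]
  have himL : AL '' Icc 0 1 = Q.boundary '' Icc (Q.mark 0) (Q.mark 2) := image_arcL Q.toJordanDomain h02.le
  have himR : AR '' Icc 0 1 = Q.boundary '' Icc (Q.mark 2) (Q.mark 0 + 1) :=
    image_arcR Q.toJordanDomain h20.le
  have hmeet : ∀ {A : ℝ → ℂ}, A '' Icc 0 1 ⊆ frontier Q.carrier →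
      P '' Icc 0 1 ∩ A '' Icc 0 1 ⊆ {P 1, P 0} := by
    intro A hA z hz
    have := image_chord_inter_frontier Q hP0 hP1 hPΩ ⟨hz.1, hA hz.2⟩
    rw [hP1, hP0]
    rcases this with h | h
    · exact Or.inr h
    · exact Or.inl h
  have hALfr : AL '' Icc 0 1 ⊆ frontier Q.carrier := by
    rw [himL]; rintro _ ⟨s, -, rfl⟩; exact Q.boundary_mem_frontier s
  have hARfr : AR '' Icc 0 1 ⊆ frontier Q.carrier := by
    rw [himR]; rintro _ ⟨s, -, rfl⟩; exact Q.boundary_mem_frontier s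
  refine ⟨{ carrier := U₁
            boundary := concatPath P AL ∘ Int.fract
            isOpen := hU₁o
            isBounded := Q.isBounded.subset hU₁Q
            isConnected := hU₁c
            continuous_boundary :=
              (continuous_concatPath hPc hALc hPAL).continuousOn.comp_fract'' h01L
            periodic_boundary := periodic_comp_fract
            injOn_boundary := injOn_comp_fract
              (injOn_concatPath_Ico hPi (injOn_arcL Q.toJordanDomain h02 h20) hPAL hALP (hmeet hALfr))
            range_boundary := by
              rw [range_comp_fract h01L, image_concatPath_Icc_zero_one hPAL, himL, hf₁] },
          { carrier := U₂
            boundary := concatPath P AR ∘ Int.fract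
            isOpen := hU₂o
            isBounded := Q.isBounded.subset hU₂Q
            isConnected := hU₂c
            continuous_boundary :=
              (continuous_concatPath hPc hARc hPAR).continuousOn.comp_fract'' h01R
            periodic_boundary := periodic_comp_fract
            injOn_boundary := injOn_comp_fract
              (injOn_concatPath_Ico hPi (injOn_arcR Q.toJordanDomain h02 h20) hPAR hARP (hmeet hARfr))
            range_boundary := by
              rw [range_comp_fract h01R, image_concatPath_Icc_zero_one hPAR, himR, hf₂] },
          rfl, rfl, hunion, hdisj, hf₁, hf₂⟩

end Chord

/-! ### Consequences for a pair of banks -/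

section Banks

variable {Q : ConformalRectangle} {P : ℝ → ℂ} {DL DR : JordanDomain}
  (hunion : DL.carrier ∪ DR.carrier = Q.carrier \ P '' Icc 0 1)
  (hdisj : Disjoint DL.carrier DR.carrier)
  (hfL : frontier DL.carrier = P '' Icc 0 1 ∪ Q.boundary '' Icc (Q.mark 0) (Q.mark 2))
  (hfR : frontier DR.carrier = P '' Icc 0 1 ∪ Q.boundary '' Icc (Q.mark 2) (Q.mark 0 + 1))

include hunion in
/-- The left bank lies in `Ω` and avoids the chord. [folklore] -/
theorem left_subset : DL.carrier ⊆ Q.carrier \ P '' Icc 0 1 := fun _ hz => hunion.le (Or.inl hz)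

include hunion in
/-- The right bank lies in `Ω` and avoids the chord. [folklore] -/
theorem right_subset : DR.carrier ⊆ Q.carrier \ P '' Icc 0 1 := fun _ hz => hunion.le (Or.inr hz)

include hfL in
/-- `c_L = Q.pt 1` lies in the closure of the left bank. [folklore] -/
theorem pt_one_mem_closure_left : Q.pt 1 ∈ closure DL.carrier := by
  rw [closure_eq_self_union_frontier, hfL]
  refine Or.inr (Or.inr ⟨Q.mark 1, ⟨?_, ?_⟩, rfl⟩)
  · exact (Q.strictMono_mark (by decide : (0 : Fin 4) < 1)).le
  · exact (Q.strictMono_mark (by decide : (1 : Fin 4) < 2)).le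

include hfR in
/-- `c_R = Q.pt 3` lies in the closure of the right bank. [folklore] -/
theorem pt_three_mem_closure_right : Q.pt 3 ∈ closure DR.carrier := by
  rw [closure_eq_self_union_frontier, hfR]
  refine Or.inr (Or.inr ⟨Q.mark 3, ⟨?_, ?_⟩, rfl⟩)
  · exact (Q.strictMono_mark (by decide : (2 : Fin 4) < 3)).le
  · linarith [(Q.mark_mem 3).2, (Q.mark_mem 0).1]

include hunion hdisj hfR in
/-- A point of the left bank is exterior to the closure of the right bank. [folklore] -/
theorem not_mem_closure_right_of_mem_left {z : ℂ} (hz : z ∈ DL.carrier) :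
    z ∉ closure DR.carrier := by
  rw [closure_eq_self_union_frontier, hfR]
  have hz' := left_subset hunion hz
  rintro (h | h | h)
  · exact Set.disjoint_left.1 hdisj hz h
  · exact hz'.2 h
  · obtain ⟨s, -, rfl⟩ := h
    exact (Set.disjoint_left.1 Q.toJordanDomain.disjoint_carrier_frontier) hz'.1
      (Q.boundary_mem_frontier s)

include hunion hdisj hfL in
/-- A point of the right bank is exterior to the closure of the left bank. [folklore] -/
theorem not_mem_closure_left_of_mem_right {z : ℂ} (hz : z ∈ DR.carrier) :
    z ∉ closure DL.carrier := by
  rw [closure_eq_self_union_frontier, hfL]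
  have hz' := right_subset hunion hz
  rintro (h | h | h)
  · exact Set.disjoint_left.1 hdisj.symm hz h
  · exact hz'.2 h
  · obtain ⟨s, -, rfl⟩ := h
    exact (Set.disjoint_left.1 Q.toJordanDomain.disjoint_carrier_frontier) hz'.1
      (Q.boundary_mem_frontier s)

/-- The index of a bank with an explicit concatenated boundary loop is the winding number of the
un-periodised concatenation. [folklore] -/
theorem index_eq_wind_concatPath {D : JordanDomain} {P A : ℝ → ℂ}
    (hD : D.boundary = concatPath P A ∘ Int.fract) (hA : A 1 = P 0) (z : ℂ) :
    D.index z = wind (fun t => concatPath P A t - z) := by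
  rw [JordanDomain.index, hD]
  refine wind_congr fun t ht => ?_
  have h01 : concatPath P A 0 = concatPath P A 1 := by rw [concatPath_zero, concatPath_one, hA]
  simp only [comp_fract_apply_of_mem_Icc h01 ht]

variable (hDL : DL.boundary = concatPath P (fun u => Q.boundary (Q.mark 2 + u * (Q.mark 0 - Q.mark 2))) ∘ Int.fract)
  (hDR : DR.boundary = concatPath P (fun u => Q.boundary (Q.mark 2 + u * (Q.mark 0 + 1 - Q.mark 2))) ∘ Int.fract)
  (hPc : Continuous P) (hP0 : P 0 = Q.pt 0) (hP1 : P 1 = Q.pt 2)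

include hDL hDR hPc hP0 hP1 hunion in
/-- **Indices of the two banks differ by minus the index of `Q`** at every point of either bank
(part A, read on the Jordan domains). [folklore] -/
theorem index_left_sub_index_right {z : ℂ} (hz : z ∈ DL.carrier ∪ DR.carrier) :
    DL.index z - DR.index z = -Q.index z := by
  have hz' : z ∈ Q.carrier \ P '' Icc 0 1 := hunion.le hz
  have hAL1 : (fun u : ℝ => Q.boundary (Q.mark 2 + u * (Q.mark 0 - Q.mark 2))) 1 = P 0 := by
    simp only [hP0]; ring_nf; rfl
  have hAR1 : (fun u : ℝ => Q.boundary (Q.mark 2 + u * (Q.mark 0 + 1 - Q.mark 2))) 1 = P 0 := by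
    simp only [hP0]
    rw [show Q.mark 2 + 1 * (Q.mark 0 + 1 - Q.mark 2) = Q.mark 0 + 1 by ring, Q.periodic_boundary]
    rfl
  rw [index_eq_wind_concatPath hDL hAL1, index_eq_wind_concatPath hDR hAR1]
  refine wind_bankLoop_sub_wind_bankLoop Q.toJordanDomain (mark_zero_lt_mark_two Q)
    (mark_two_lt_mark_zero_add_one Q) hPc.continuousOn hP0 hP1 (fun t ht h => hz'.2 ⟨t, ht, h⟩) ?_
  exact fun h => (Set.disjoint_left.1 Q.toJordanDomain.disjoint_carrier_frontier) hz'.1 h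

include hDL hDR hPc hP0 hP1 hunion hdisj hfR in
/-- **The index of the left bank is minus the index of `Q`.** [folklore] -/
theorem index_left_eq {z : ℂ} (hz : z ∈ DL.carrier) : DL.index z = -Q.index z := by
  have h := index_left_sub_index_right hunion hDL hDR hPc hP0 hP1 (Or.inl hz)
  rw [DR.index_eq_zero_of_mem_exterior (not_mem_closure_right_of_mem_left hunion hdisj hfR hz)] at h
  simpa using h

include hDL hDR hPc hP0 hP1 hunion hdisj hfL in
/-- **The index of the right bank is the index of `Q`.** [folklore] -/
theorem index_right_eq {z : ℂ} (hz : z ∈ DR.carrier) : DR.index z = Q.index z := by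
  have h := index_left_sub_index_right hunion hDL hDR hPc hP0 hP1 (Or.inr hz)
  rw [DL.index_eq_zero_of_mem_exterior (not_mem_closure_left_of_mem_right hunion hdisj hfL hz)] at h
  linarith

end Banks

end Summit.CriticalPhenomena.SAWScalingLimit.Theorems.WeldingContinuity

end
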